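import Literature.AnabelianGeometry.EtaleTheta.SettingModelKrullSemidirect
import Literature.AnabelianGeometry.EtaleTheta.SettingModelChiTheta
import HarnessLib

/-!
# The UNTWISTED KRULL model of the [EtTh] §1 root, file K2: the record `ThetaSetting.modelκ p`
# (abc-iut-L2-t1's F5b `SettingModelChiTheta` transcribed with `χ ↦ 1`)

Mochizuki, *The étale theta function …*, Publ. RIMS **45** (2009) [EtTh], §1, PRIMS PDF pp. 11–14
[cite: MochizukiEtTh2009, §1 p.12]: «`Π^tp_X ↠ (Π^tp_X)^Θ ↠ (Π^tp_X)^ell`», «`Y_N`», «`Z_N`», «`Δ_X` … profinite free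
on 2 generators». Cell abc-iut, layer L2, seat abc-iut-L2-t10 (gen 5), row «coverDataAx FULLY INSTANTIATED», file K2
over K1a/K1b (`SettingModelKrullCoverings`, `SettingModelKrullSemidirect`): the `ThetaSetting` record over the carrier
`curveκ p` — theta quotients from abc-iut-L2-d1's generic `CurveTheta`, coverings `YNκ/ZNκ`, `q_X := p²`, `K := ℚ_p` —
**`ThetaSetting.modelκ p`**, with `modelκ_isEtThOrigin`, `hYcl_modelκ` (the image of `Δ^tp_Y` in `Π_X` is closed),
`isOpenMap_aug_modelκ`. SEMI-SYNTHETIC (consistency evidence only; trivial Galois action on `Γ` — the Tate/Kummer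
clauses are NOT claimed; this model serves the §2 cover/cusp-position layer). Class (b); nothing of [EtTh] asserted;
no side taken on [IUTchIII] Cor. 3.12; typed ≠ proved.
-/

noncomputable section

namespace Literature.AnabelianGeometry.EtaleTheta.SettingModel

open Literature.AnabelianGeometry.SemiGraphs

variable (p : ℕ) [Fact p.Prime]

/-- `Ker(Π^tp_X ↠ (Π^tp_X)^Θ) ⊴ Π^tp_X` re-exported at the carrier of `curveκ` (instance retrieval keys the generic
`CurveTheta.thetaKer_normal` on the concrete `TemperedCurve` term — usage note of `ThetaQuotientsOfCurve`).
[cite: MochizukiEtTh2009, §1 p.12] -/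
instance thetaKerκ_normal : (CurveTheta.thetaKer (curveκ p)).Normal := CurveTheta.thetaKer_normal _

/-- `Ker(Π^tp_X ↠ (Π^tp_X)^ell) ⊴ Π^tp_X` re-exported at the carrier of `curveκ`. [cite: MochizukiEtTh2009, §1 p.12] -/
instance ellKerκ_normal : (CurveTheta.ellKer (curveκ p)).Normal := CurveTheta.ellKer_normal _

/-- `Δ_X ≤ inl(F̂₂)` in `Π_X = F̂₂ ⋊_κ G_{ℚ_p}`. [cite: MochizukiEtTh2009, §1 p.12] -/
theorem deltaHatκ_le_range_inl :
    (curveκ p).DeltaHat ≤ (SemidirectProduct.inl : F₂hatT →* PiHtκ p).range := by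
  rw [deltaHatκ_eq, ← SemidirectProduct.range_inl_eq_ker_rightHom]

/-- **The level maps kill `Ker(Π^tp_X ↠ (Π^tp_X)^Θ)`** at the κ-model: for `g` in the theta kernel and every `N`,
`ĥ_N(pr₁ g.left) = 1`. [cite: MochizukiEtTh2009, §1 p.14] -/
theorem levelHom_eq_one_of_mem_thetaKerκ {g : PiTpκ p} (hg : g ∈ CurveTheta.thetaKer (curveκ p)) (N : ℕ+) :
    levelHom N g.left = 1 := by
  have hmem : toHatκ p g ∈
      (⁅⁅(curveκ p).DeltaHat, (curveκ p).DeltaHat⁆, (curveκ p).DeltaHat⁆).topologicalClosure := hg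
  have h := hHat_left_eq_one_of_mem_closure_commutator₃_of_le (isInducing_leftRightHatκ p)
    (deltaHatκ_le_range_inl p) hmem N
  show hHat N (gfpFst g.left) = 1
  rw [← toHatκ_left p g]
  exact h.1

/-- **`Ker(Π^tp_X ↠ (Π^tp_X)^Θ) ∩ Π^tp_{Y_N} ≤ Π^tp_{Z_N}`** in the κ-model. [cite: MochizukiEtTh2009, §1 p.14] -/
theorem thetaKer_inf_YNκ_le_ZNκ (N : ℕ+) : CurveTheta.thetaKer (curveκ p) ⊓ YNκ p N ≤ ZNκ p N := by
  intro g hg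
  obtain ⟨hT, hY⟩ := Subgroup.mem_inf.mp hg
  have hright : g.right = 1 := (mem_deltaTempκ_iff p g).mp (CurveTheta.thetaKer_le_deltaTemp (curveκ p) hT)
  exact (krullTwistData p).mem_ZN_of_levelHom_eq_one hY (levelHom_eq_one_of_mem_thetaKerκ p hT N)
    (by rw [hright]; exact Subgroup.one_mem _)

/-- **The κ-twisted model of the [EtTh] §1 root** (`Π^tp_X := (F̂₂ ×_Ẑ ℤ) ⋊_κ G_{ℚ_p}`, `K := ℚ_p`, `q_X := p²`,
`Y_N`/`Z_N` from the profinite level maps twisted by `G_{K_N}`/`G_{J_N}`). SEMI-SYNTHETIC (not the tempered `π₁`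
of a curve). [cite: MochizukiEtTh2009, §1 p.11] -/
abbrev _root_.Literature.AnabelianGeometry.EtaleTheta.ThetaSetting.modelκ : ThetaSetting p where
  toTemperedCurve := curveκ p
  qX := qModel p
  qX_mem := qModel_mem_botχ p
  norm_qX_lt_one := (ThetaSetting.model p).norm_qX_lt_one
  qX_ne_zero := qModel_ne_zeroχ p
  sqrtqX := ((p : ℕ) : PadicAlgCl p)
  sqrtqX_sq := rfl
  toZ := (krullTwistData p).toZ
  toZ_surjective := (krullTwistData p).toZ_surjective
  isOpen_ker_toZ := (krullTwistData p).isOpen_ker_toZ (continuous_leftRightκ p)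
  toZ_delta_surjective := (krullTwistData p).toZ_restrict_surjective
  GtpTheta := CurveTheta.GTheta (curveκ p)
  toTheta := CurveTheta.toTheta (curveκ p)
  continuous_toTheta := CurveTheta.continuous_toTheta (curveκ p)
  toTheta_surjective := CurveTheta.toTheta_surjective (curveκ p)
  ker_toTheta := CurveTheta.ker_toTheta (curveκ p)
  GtpEll := CurveTheta.GEll (curveκ p)
  thetaToEll := CurveTheta.thetaToEll (curveκ p)
  continuous_thetaToEll := CurveTheta.continuous_thetaToEll (curveκ p)
  thetaToEll_surjective := CurveTheta.thetaToEll_surjective (curveκ p)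
  ker_toEll := CurveTheta.ker_toEll (curveκ p)
  ker_thetaToEll_comm := CurveTheta.ker_thetaToEll_comm (curveκ p)
  ker_thetaToEll_central := CurveTheta.ker_thetaToEll_central (curveκ p)
  GtpYN := YNκ p
  GtpYN_one := YNκ_one p
  GtpYN_le := YNκ_le p
  map_aug_GtpYN N := map_rightHom_YNκ p N
  GtpYN_normal := YNκ_normal p
  isOpen_GtpYN N := isOpen_YNκ p (continuous_leftRightκ p) N (isOpen_fixingSubgroup_fieldKN ⊥ (qModel p) N)
  GtpYN_anti M N h := YNκ_anti p h
  relIndex_deltaYN N := relIndex_YNκ p N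
  GtpZN := ZNκ p
  GtpZN_le := ZNκ_le_YNκ p
  map_aug_GtpZN N := map_rightHom_ZNκ p N
  GtpZN_normal := ZNκ_normal p
  isOpen_GtpZN N := isOpen_ZNκ p (continuous_leftRightκ p) N (isOpen_fixingSubgroup_fieldJN ⊥ (qModel p) N)
  GtpZN_anti M N h := ZNκ_anti p h
  relIndex_deltaZN N := relIndex_ZNκ p N
  ker_toTheta_le_GtpZN N := by
    rw [CurveTheta.ker_toTheta]
    exact thetaKer_inf_YNκ_le_ZNκ p N

/-- **The κ-model satisfies the guard `IsEtThOrigin`** (`Δ_X = inl(F̂₂)` is profinite free on two generators).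
[cite: MochizukiEtTh2009, §1 p.12] -/
theorem _root_.Literature.AnabelianGeometry.EtaleTheta.ThetaSetting.modelκ_isEtThOrigin :
    (ThetaSetting.modelκ p).IsEtThOrigin :=
  ThetaSetting.IsEtThOrigin.of_free (isFreeProfiniteOnTwo_deltaHatκ p)

/-- **The image of `Δ^tp_Y` in `Π_X` is `inl(Ker ê)`** (κ-model). [cite: MochizukiEtTh2009, §1 p.12] -/
theorem coe_map_dtpY_modelκ : ((ThetaSetting.modelκ p).DtpY.map (ThetaSetting.modelκ p).toHat.toMonoidHom :
    Set (PiHtκ p)) = (SemidirectProduct.inl : F₂hatT → PiHtκ p) '' (eHat ⁻¹' {1}) := by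
  ext y
  constructor
  · rintro ⟨g, hg, rfl⟩
    obtain ⟨hg1, hg2⟩ := Subgroup.mem_inf.mp hg
    have hsnd : gfpSnd g.left = 1 := hg1
    have hright : g.right = 1 := (mem_deltaTempκ_iff p g).mp hg2
    refine ⟨gfpFst g.left, ?_, ?_⟩
    · show eHat (gfpFst g.left) = 1
      rw [gfpFst_apply, (mem_Gfp _).mp g.left.2, ← gfpSnd_apply, hsnd, map_one]
    · apply SemidirectProduct.ext
      · rw [SemidirectProduct.left_inl]
        exact (toHatκ_left p g).symm
      · rw [SemidirectProduct.right_inl]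
        exact ((toHatκ_right p g).trans hright).symm
  · rintro ⟨x, hx, rfl⟩
    have hx' : eHat x = 1 := hx
    let γ : Gfp := ⟨(x, 1), by rw [mem_Gfp, hx', map_one]⟩
    refine ⟨SemidirectProduct.inl γ, Subgroup.mem_inf.mpr ⟨?_, ?_⟩, ?_⟩
    · show gfpSnd (SemidirectProduct.inl γ : PiTpκ p).left = 1
      rw [SemidirectProduct.left_inl, gfpSnd_apply]
    · exact (mem_deltaTempκ_iff p _).mpr (SemidirectProduct.right_inl γ)
    · apply SemidirectProduct.ext
      · show (toHatκ p (SemidirectProduct.inl γ)).left = x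
        rw [toHatκ_left, SemidirectProduct.left_inl, gfpFst_apply]
      · show (toHatκ p (SemidirectProduct.inl γ)).right = 1
        rw [toHatκ_right, SemidirectProduct.right_inl]

/-- **`hYcl` HOLDS in the κ-model**: the image of `Δ^tp_Y` in `Π_X` is closed (so its closure is itself, a fortiori
inside image `⊔ [[Δ_X,Δ_X],Δ_X]⁻`). [cite: MochizukiEtTh2009, §1 p.12] -/
theorem hYcl_modelκ :
    ((ThetaSetting.modelκ p).DtpY.map (ThetaSetting.modelκ p).toHat.toMonoidHom).topologicalClosure ≤
      (ThetaSetting.modelκ p).DtpY.map (ThetaSetting.modelκ p).toHat.toMonoidHom ⊔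
        (⁅⁅(ThetaSetting.modelκ p).DeltaHat, (ThetaSetting.modelκ p).DeltaHat⁆,
          (ThetaSetting.modelκ p).DeltaHat⁆).topologicalClosure := by
  refine (Subgroup.topologicalClosure_minimal _ le_rfl ?_).trans le_sup_left
  show IsClosed (((ThetaSetting.modelκ p).DtpY.map (ThetaSetting.modelκ p).toHat.toMonoidHom : Subgroup (PiHtκ p)) :
    Set (PiHtκ p))
  rw [coe_map_dtpY_modelκ]
  exact isClosed_image_inl (isInducing_leftRightHatκ p) (isClosed_singleton.preimage eHat.continuous)

/-- **Root + guard + `hYcl` hold together at the κ-model** (non-trivial Galois action on `Δ_Θ`).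
[cite: MochizukiEtTh2009, §1 p.12] -/
theorem _root_.Literature.AnabelianGeometry.EtaleTheta.ThetaSetting.modelκ_isEtThOrigin_and_hYcl :
    (ThetaSetting.modelκ p).IsEtThOrigin ∧
      ((ThetaSetting.modelκ p).DtpY.map (ThetaSetting.modelκ p).toHat.toMonoidHom).topologicalClosure ≤
        (ThetaSetting.modelκ p).DtpY.map (ThetaSetting.modelκ p).toHat.toMonoidHom ⊔
          (⁅⁅(ThetaSetting.modelκ p).DeltaHat, (ThetaSetting.modelκ p).DeltaHat⁆,
            (ThetaSetting.modelκ p).DeltaHat⁆).topologicalClosure :=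
  ⟨ThetaSetting.modelκ_isEtThOrigin p, hYcl_modelκ p⟩

/-- **`aug` is an OPEN map at the κ-model** (the clause that FAILS at the discrete-Galois models `model`/`model₂`,
abc-iut-L2-t11's `SettingModelAugNotOpen`). [cite: MochizukiEtTh2009, §1 p.12] -/
theorem isOpenMap_aug_modelκ : IsOpenMap (ThetaSetting.modelκ p).aug := isOpenMap_augκ p

end Literature.AnabelianGeometry.EtaleTheta.SettingModel

end
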